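import Literature.AlgebraicGeometry.RelativeSpec.GeometricQuotient
import Literature.AlgebraicGeometry.RelativeSpec.FiniteGroupQuotient
import Literature.AlgebraicGeometry.Modules.PullbackPushforwardTraceChart
import Literature.AlgebraicGeometry.Modules.PullbackQuasicoherent
import Literature.AlgebraicGeometry.Modules.PullbackPushforwardTwist
import Literature.AlgebraicGeometry.Modules.SectionsExact
import Literature.AlgebraicGeometry.Modules.AffineLocalizingClosure
import Literature.AlgebraicGeometry.Modules.QuasicoherentAbelian
import Literature.AlgebraicGeometry.Modules.PushforwardClosedImmersionCoh
import Literature.AlgebraicGeometry.HodgeTheory.CotangentSheafPullbackHom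
import HarnessLib

/-!
# Equivariant quasi-coherent modules along a quotient morphism: the action on `p_* E`, the module
# of invariants `(p_* E)^G`, and the comparison `p^* (p_* E)^G ⟶ E`

Let a group `G` act on a scheme `X` over `Q` (`ρ : ActionOver p G` of
`RelativeSpec/FiniteGroupQuotient`: automorphisms `ρ.aut g` of `X` with `ρ.aut g ≫ p = p`), and let
`E` be an `𝒪_X`-module with a **`G`-equivariant structure** (descent datum, `G`-linearisation):
isomorphisms `φ g : (ρ.aut g)^* E ≅ E` in Mathlib's `Scheme.Modules`, subject to the unit and
cocycle conditions `φ 1 = can`, `φ (g h) = can ≫ (ρ.aut h)^*(φ g) ≫ φ h`, which are spelled out as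
the explicit hypotheses `hunit`, `hcocycle` wherever used (no structure is introduced; Mumford,
*Abelian Varieties* §12; [MFK94] Ch. 1 §3 Def. 1.6). This file constructs:

* `ActionOver.pushforwardAct ρ E φ g : p_* E ⟶ p_* E` — the action of `g` on the direct image
  (`p_* θ_g` for the adjunct `θ_g : E ⟶ (ρ.aut g)_* E` of `φ g`, followed by
  `p_* (ρ.aut g)_* = (ρ.aut g ≫ p)_* = p_*`) and its sections `actSections ρ E φ g V` on
  `Γ(E, p⁻¹V) = Γ(p_* E, V)`, `s ↦ φ_g(η_{ρ.aut g}(s))` (`actSections_eq`);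
* the laws on sections: semilinearity `g · (b s) = (ρ.aut g)♯(b) · (g · s)` (`actSections_smul`),
  `1 · s = s` from the unit condition (`actSections_one`), `(g h) · s = h · (g · s)` from the
  cocycle condition (`actSections_mul`; `G` acts on the left on `X`, hence on the right on
  sections);
* `ActionOver.moduleInvariants ρ E φ = (p_* E)^G := ker (p_* E ⟶ ∏_g p_* E, s ↦ (g · s - s)_g)`
  with its inclusion `moduleInvariantsι`, the description of its sections
  (`mem_range_moduleInvariantsι_app_iff`: a section of `p_* E` comes from `(p_* E)^G` iff
  `g · s = s` for all `g`) and its quasi-coherence for `p` affine, `E` quasi-coherent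
  (`isAffineLocalizing_moduleInvariants`; Stacks 01LA via `Modules/QuasicoherentAbelian`);
* `ActionOver.descentHom ρ E φ : p^* (p_* E)^G ⟶ E`, the adjunct of the inclusion, with
  `descentHom_app_unitSection`: `η_p(x) ↦ ι(x)`;
* section-level bookkeeping for Mathlib's abstract inverse image (`counit_app_unitSection`),
  continuing `Modules/PullbackAffineChart` and `HodgeTheory/CotangentSheafPullbackHom`
  (`pullbackId_hom_app_unitSection`, `pullbackObj_hom_ext_unitSection`, reused from there).

The sequel `RelativeSpec/EquivariantModuleDescent` proves that `descentHom` is an isomorphism for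
an affine geometric quotient by a free action (Galois descent of quasi-coherent modules; affine
engine `GaloisAlgebras/ChaseHarrisonRosenbergDescent`). Everything here is proved; no named facts;
the `def`s are constructions with bodies.

## References

* [MumfordAV1970] D. Mumford, *Abelian Varieties* (1970), §7 Thm. p. 66 (2) (`(π_* 𝒪_X)^G`,
  `(π_* F)^G`) and §12 Thm. 1 (p. 112) (descent of sheaves along `X → X/G`, free action).
* [MumfordFogartyKirwan1994] D. Mumford, J. Fogarty, F. Kirwan, *Geometric Invariant Theory*,
  3rd ed. (1994), Ch. 1 §3 (`G`-linearised sheaves), Prop. 7.1 (descent along a principal bundle).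
* [Greither1992CyclicGalois] C. Greither, LNM 1534 (1992), Ch. 0 §7 (Galois descent).
-/

noncomputable section

-- `TopCat.Presheaf`/`Scheme.Modules` are not reducible (as in Mathlib's `AlgebraicGeometry/Modules`).
set_option backward.isDefEq.respectTransparency false

universe u

open CategoryTheory Limits AlgebraicGeometry TopologicalSpace Opposite
open Literature.AlgebraicGeometry.Modules

namespace Literature.AlgebraicGeometry.RelativeSpec

/-! ### Preliminaries: sections of Mathlib's abstract inverse image -/

section Sections

variable {X Y : Scheme.{u}}

/-- Restrictions of a section of a module along two chains of morphisms of opens with the same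
ends agree. [cite: Hartshorne1977, II.1 (p. 61) and II.5 (p. 109)] -/
theorem presheaf_map_map_congr (N : X.Modules) {W₁ W₂ W₃ : X.Opens} (i : W₂ ⟶ W₁) (j : W₃ ⟶ W₂)
    (k : W₃ ⟶ W₁) (x : Γ(N, W₁)) :
    N.presheaf.map j.op (N.presheaf.map i.op x) = N.presheaf.map k.op x := by
  rw [← CategoryTheory.comp_apply, ← Functor.map_comp, ← op_comp]
  exact presheaf_map_congr N _ _ x

/-- A section restricted along an endomorphism of an open is unchanged. [cite: Hartshorne1977, II.1 (p. 61)] -/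
theorem presheaf_map_self (N : X.Modules) {W : X.Opens} (i : W ⟶ W) (x : Γ(N, W)) :
    N.presheaf.map i.op x = x := by
  rw [Subsingleton.elim i (𝟙 W), op_id, CategoryTheory.Functor.map_id]; rfl

/-- Naturality of the components of a morphism of modules with respect to restriction, applied
to an element. [cite: Hartshorne1977, II.1 (p. 61) and II.5 (p. 109)] -/
theorem app_presheaf_map {M N : X.Modules} (ψ : M ⟶ N) {U W : X.Opens} (i : U ⟶ W) (y : Γ(M, W)) :
    ψ.app U (M.presheaf.map i.op y) = N.presheaf.map i.op (ψ.app W y) :=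
  ConcreteCategory.congr_hom (ψ.mapPresheaf.naturality i.op) y

/-- The counit of `f^* ⊣ f_*` kills the unit on sections: `ε(η(s)) = s` for `s ∈ Γ(f_* N, V)`
(right triangle identity). [cite: Hartshorne1977, II.5 (p. 110)] -/
theorem counit_app_unitSection (f : X ⟶ Y) (N : X.Modules) (V : Y.Opens)
    (s : Γ((Scheme.Modules.pushforward f).obj N, V)) :
    ((Scheme.Modules.pullbackPushforwardAdjunction f).counit.app N).app (f ⁻¹ᵁ V)
      (unitSection f ((Scheme.Modules.pushforward f).obj N) V s) = s := by
  have h := congrArg (fun ψ => (Scheme.Modules.Hom.app ψ V) s)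
    ((Scheme.Modules.pullbackPushforwardAdjunction f).right_triangle_components N)
  simp only [Scheme.Modules.Hom.comp_app, CategoryTheory.comp_apply,
    Scheme.Modules.pushforward_map_app, Scheme.Modules.Hom.id_app, CategoryTheory.id_apply] at h
  exact h

end Sections

namespace ActionOver

variable {X Q : Scheme.{u}} {p : X ⟶ Q} {G : Type u} [Group G] (ρ : ActionOver p G)
variable (E : X.Modules) (φ : ∀ g : G, (Scheme.Modules.pullback (ρ.aut g).hom).obj E ≅ E)

/-! ### The action on `p_* E` and on its sections -/

/-- `(ρ.aut (g * h)).hom = (ρ.aut h).hom ≫ (ρ.aut g).hom`. [cite: MumfordAV1970, §7 Thm. p. 66] -/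
theorem aut_mul_hom (g h : G) : (ρ.aut (g * h)).hom = (ρ.aut h).hom ≫ (ρ.aut g).hom := by
  rw [map_mul, CategoryTheory.Aut.Aut_mul_def]; rfl

/-- `(ρ.aut 1).hom = 𝟙 X`. [cite: MumfordAV1970, §7 Thm. p. 66] -/
theorem aut_one_hom : (ρ.aut 1).hom = 𝟙 X := by
  rw [map_one]; rfl

/-- The adjunct `θ_g : E ⟶ (ρ.aut g)_* E` of `φ g : (ρ.aut g)^* E ≅ E`. [cite: MumfordFogartyKirwan1994, Ch. 1 §3 Def. 1.6 (p. 30)] -/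
def twistHom (g : G) : E ⟶ (Scheme.Modules.pushforward (ρ.aut g).hom).obj E :=
  (Scheme.Modules.pullbackPushforwardAdjunction (ρ.aut g).hom).unit.app E ≫
    (Scheme.Modules.pushforward (ρ.aut g).hom).map (φ g).hom

/-- Sections of `θ_g`: `s ↦ φ_g(η_{ρ.aut g}(s))`. [cite: MumfordFogartyKirwan1994, Ch. 1 §3 Def. 1.6 (p. 30)] -/
theorem twistHom_app (g : G) (U : X.Opens) (s : Γ(E, U)) :
    (ρ.twistHom E φ g).app U s =
      (φ g).hom.app ((ρ.aut g).hom ⁻¹ᵁ U) (unitSection (ρ.aut g).hom E U s) := by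
  simp only [twistHom, Scheme.Modules.Hom.comp_app, Scheme.Modules.pushforward_map_app]
  rfl

/-- **The action of `g` on `p_* E`**: `p_* θ_g` followed by `p_* (ρ.aut g)_* E = (ρ.aut g ≫ p)_* E
= p_* E`. [cite: MumfordFogartyKirwan1994, Ch. 1 §3 Def. 1.6 (p. 30)] -/
def pushforwardAct (g : G) :
    (Scheme.Modules.pushforward p).obj E ⟶ (Scheme.Modules.pushforward p).obj E :=
  (Scheme.Modules.pushforward p).map (ρ.twistHom E φ g) ≫
    (Scheme.Modules.pushforwardComp (ρ.aut g).hom p).hom.app E ≫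
      (Scheme.Modules.pushforwardCongr (ρ.aut_comp g)).hom.app E

/-- Sections of the action: `s ↦ φ_g(η_{ρ.aut g}(s))`, transported along
`(ρ.aut g)⁻¹(p⁻¹V) = p⁻¹V`. [cite: MumfordFogartyKirwan1994, Ch. 1 §3 Def. 1.6 (p. 30)] -/
theorem pushforwardAct_app (g : G) (V : Q.Opens) (s : Γ(E, p ⁻¹ᵁ V)) :
    (ρ.pushforwardAct E φ g).app V s =
      E.presheaf.map (eqToHom (ρ.preimage_preimage g V).symm).op
        ((φ g).hom.app ((ρ.aut g).hom ⁻¹ᵁ (p ⁻¹ᵁ V)) (unitSection (ρ.aut g).hom E (p ⁻¹ᵁ V) s)) := by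
  simp only [pushforwardAct, Scheme.Modules.Hom.comp_app, Scheme.Modules.pushforward_map_app,
    Scheme.Modules.pushforwardComp_hom_app_app, Scheme.Modules.pushforwardCongr_hom_app_app,
    CategoryTheory.comp_apply]
  exact presheaf_map_congr _ _ _ _

/-- **The action of `g` on the sections `Γ(E, p⁻¹V)`** (the sections of `pushforwardAct` over
`V`, with source and target spelled `Γ(E, p⁻¹V)`). [cite: MumfordFogartyKirwan1994, Ch. 1 §3 Def. 1.6 (p. 30)] -/
def actSections (g : G) (V : Q.Opens) : Γ(E, p ⁻¹ᵁ V) →+ Γ(E, p ⁻¹ᵁ V) :=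
  ((ρ.pushforwardAct E φ g).app V).hom

/-- `actSections` is the sections map of `pushforwardAct`. [cite: MumfordFogartyKirwan1994, Ch. 1 §3 Def. 1.6 (p. 30)] -/
theorem actSections_apply (g : G) (V : Q.Opens) (s : Γ(E, p ⁻¹ᵁ V)) :
    ρ.actSections E φ g V s = (ρ.pushforwardAct E φ g).app V s := rfl

/-- Sections formula for `actSections`: `s ↦ φ_g(η_{ρ.aut g}(s))` transported to `p⁻¹V`.
[cite: MumfordFogartyKirwan1994, Ch. 1 §3 Def. 1.6 (p. 30)] -/
theorem actSections_eq (g : G) (V : Q.Opens) (s : Γ(E, p ⁻¹ᵁ V)) :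
    ρ.actSections E φ g V s =
      E.presheaf.map (eqToHom (ρ.preimage_preimage g V).symm).op
        ((φ g).hom.app ((ρ.aut g).hom ⁻¹ᵁ (p ⁻¹ᵁ V)) (unitSection (ρ.aut g).hom E (p ⁻¹ᵁ V) s)) :=
  ρ.pushforwardAct_app E φ g V s

/-- **Semilinearity of the action on sections**: `g · (b s) = (ρ.aut g)♯(b) · (g · s)`.
[cite: MumfordFogartyKirwan1994, Ch. 1 §3 Def. 1.6 (p. 30)] -/
theorem actSections_smul (g : G) (V : Q.Opens) (b : Γ(X, p ⁻¹ᵁ V)) (s : Γ(E, p ⁻¹ᵁ V)) :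
    ρ.actSections E φ g V (b • s) =
      (ρ.aut g).hom.appLE (p ⁻¹ᵁ V) (p ⁻¹ᵁ V) (ρ.preimage_preimage g V).ge b •
        ρ.actSections E φ g V s := by
  rw [actSections_eq, actSections_eq, unitSection_smul, Scheme.Modules.Hom.app_smul,
    Scheme.Modules.map_smul]
  congr 1

/-- **Unit law of the action on sections**: `1 · s = s`, from the unit condition of the
equivariant structure `φ 1 = can`. [cite: MumfordFogartyKirwan1994, Ch. 1 §3 Def. 1.6 (p. 30)] -/
theorem actSections_one
    (hunit : (φ 1).hom = ((Scheme.Modules.pullbackCongr ρ.aut_one_hom).app E).hom ≫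
      ((Scheme.Modules.pullbackId X).app E).hom)
    (V : Q.Opens) (s : Γ(E, p ⁻¹ᵁ V)) :
    ρ.actSections E φ 1 V s = s := by
  rw [actSections_eq, hunit]
  simp only [Iso.app_hom, Scheme.Modules.Hom.comp_app, CategoryTheory.comp_apply]
  rw [pullbackCongr_hom_app_unitSection, app_presheaf_map]
  have hid : ((Scheme.Modules.pullbackId X).hom.app E).app ((𝟙 X) ⁻¹ᵁ (p ⁻¹ᵁ V))
      (unitSection (𝟙 X) E (p ⁻¹ᵁ V) s) = s :=
    Literature.AlgebraicGeometry.HodgeTheory.pullbackId_hom_app_unitSection E (p ⁻¹ᵁ V) s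
  erw [hid]
  exact (presheaf_map_map_congr E _ _ (𝟙 _) s).trans (presheaf_map_self E _ s)

/-- **Multiplication law of the action on sections**: `(g h) · s = h · (g · s)` (the
automorphisms act on the left on `X`, so on the right on sections), from the cocycle condition
of the equivariant structure. [cite: MumfordFogartyKirwan1994, Ch. 1 §3 Def. 1.6 (p. 30)] -/
theorem actSections_mul
    (hcocycle : ∀ g h : G, (φ (g * h)).hom =
      ((Scheme.Modules.pullbackCongr (ρ.aut_mul_hom g h)).app E).hom ≫
        ((Scheme.Modules.pullbackComp (ρ.aut h).hom (ρ.aut g).hom).app E).inv ≫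
          (Scheme.Modules.pullback (ρ.aut h).hom).map (φ g).hom ≫ (φ h).hom)
    (g h : G) (V : Q.Opens) (s : Γ(E, p ⁻¹ᵁ V)) :
    ρ.actSections E φ (g * h) V s = ρ.actSections E φ h V (ρ.actSections E φ g V s) := by
  rw [actSections_eq, actSections_eq, actSections_eq, hcocycle g h]
  simp only [Iso.app_hom, Iso.app_inv, Scheme.Modules.Hom.comp_app, CategoryTheory.comp_apply]
  -- left-hand side: push the transports outwards through the three morphisms
  rw [pullbackCongr_hom_app_unitSection, app_presheaf_map]
  have hc : ((Scheme.Modules.pullbackComp (ρ.aut h).hom (ρ.aut g).hom).inv.app E).app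
        (((ρ.aut h).hom ≫ (ρ.aut g).hom) ⁻¹ᵁ (p ⁻¹ᵁ V))
        (unitSection ((ρ.aut h).hom ≫ (ρ.aut g).hom) E (p ⁻¹ᵁ V) s) =
      unitSection (ρ.aut h).hom ((Scheme.Modules.pullback (ρ.aut g).hom).obj E)
        ((ρ.aut g).hom ⁻¹ᵁ (p ⁻¹ᵁ V)) (unitSection (ρ.aut g).hom E (p ⁻¹ᵁ V) s) :=
    pullbackComp_inv_app_unitSection (ρ.aut g).hom E (ρ.aut h).hom (p ⁻¹ᵁ V) s
  erw [hc]
  have hm : ((Scheme.Modules.pullback (ρ.aut h).hom).map (φ g).hom).app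
        ((ρ.aut h).hom ⁻¹ᵁ ((ρ.aut g).hom ⁻¹ᵁ (p ⁻¹ᵁ V)))
        (unitSection (ρ.aut h).hom ((Scheme.Modules.pullback (ρ.aut g).hom).obj E)
          ((ρ.aut g).hom ⁻¹ᵁ (p ⁻¹ᵁ V)) (unitSection (ρ.aut g).hom E (p ⁻¹ᵁ V) s)) =
      unitSection (ρ.aut h).hom E ((ρ.aut g).hom ⁻¹ᵁ (p ⁻¹ᵁ V))
        ((φ g).hom.app ((ρ.aut g).hom ⁻¹ᵁ (p ⁻¹ᵁ V)) (unitSection (ρ.aut g).hom E (p ⁻¹ᵁ V) s)) :=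
    pullback_map_app_unitSection (ρ.aut h).hom (φ g).hom _ _
  rw [app_presheaf_map]
  erw [hm]
  rw [app_presheaf_map]
  -- right-hand side: `η_{σ_h}` of a transported section is a transported section
  rw [unitSection_map, app_presheaf_map]
  have e : p ⁻¹ᵁ V = ((ρ.aut h).hom ≫ (ρ.aut g).hom) ⁻¹ᵁ (p ⁻¹ᵁ V) := by
    rw [← ρ.aut_mul_hom, ρ.preimage_preimage]
  exact (presheaf_map_map_congr E _ _ (eqToHom e) _).trans
    (presheaf_map_map_congr E _ _ (eqToHom e) _).symm

/-! ### The module of invariants `(p_* E)^G` -/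

section Invariants

variable [Fintype G]

/-- The morphism `p_* E ⟶ ∏_{g ∈ G} p_* E`, `s ↦ (g · s - s)_g`, whose kernel is the module of
invariants. [cite: MumfordAV1970, §7 Thm. p. 66 (2)] -/
def invariantsDefect :
    (Scheme.Modules.pushforward p).obj E ⟶ ∏ᶜ fun _ : G => (Scheme.Modules.pushforward p).obj E :=
  Pi.lift fun g => ρ.pushforwardAct E φ g - 𝟙 _

/-- **The module of invariants** `(p_* E)^G = ker (s ↦ (g · s - s)_g)` of the `G`-action on `p_* E`
induced by the equivariant structure `φ` (Mumford, *Abelian Varieties* §7: `(π_* F)^G`).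
[cite: MumfordAV1970, §7 Thm. p. 66 (2) and §12 Thm. 1] -/
def moduleInvariants : Q.Modules :=
  kernel (ρ.invariantsDefect E φ)

/-- The inclusion `(p_* E)^G ⟶ p_* E`. [cite: MumfordAV1970, §7 Thm. p. 66 (2)] -/
def moduleInvariantsι : ρ.moduleInvariants E φ ⟶ (Scheme.Modules.pushforward p).obj E :=
  kernel.ι (ρ.invariantsDefect E φ)

/-- The inclusion of the invariants is a monomorphism. [cite: MumfordAV1970, §7 Thm. p. 66 (2)] -/
theorem mono_moduleInvariantsι : Mono (ρ.moduleInvariantsι E φ) := by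
  unfold moduleInvariantsι; infer_instance

/-- The inclusion of the invariants is injective on sections. [cite: MumfordAV1970, §7 Thm. p. 66 (2)] -/
theorem moduleInvariantsι_app_injective (V : Q.Opens) :
    Function.Injective ((ρ.moduleInvariantsι E φ).app V) :=
  kernel_ι_app_injective _ V

/-- The `g`-component of `s ↦ (g · s - s)_g` on sections. [cite: MumfordAV1970, §7 Thm. p. 66 (2)] -/
theorem pi_π_app_invariantsDefect_app (g : G) (V : Q.Opens) (s : Γ(E, p ⁻¹ᵁ V)) :
    ((Pi.π (fun _ : G => (Scheme.Modules.pushforward p).obj E) g).app V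
        ((ρ.invariantsDefect E φ).app V s) : Γ(E, p ⁻¹ᵁ V)) =
      ρ.actSections E φ g V s - s := by
  rw [← CategoryTheory.comp_apply, ← Scheme.Modules.Hom.comp_app, invariantsDefect, Pi.lift_π]
  rfl

/-- A section is killed by `s ↦ (g · s - s)_g` iff it is fixed by every `g`. [cite: MumfordAV1970, §7 Thm. p. 66 (2)] -/
theorem invariantsDefect_app_eq_zero_iff (V : Q.Opens) (s : Γ(E, p ⁻¹ᵁ V)) :
    (ρ.invariantsDefect E φ).app V s = 0 ↔ ∀ g : G, ρ.actSections E φ g V s = s := by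
  constructor
  · intro h g
    have hg := ρ.pi_π_app_invariantsDefect_app E φ g V s
    rw [h, map_zero] at hg
    exact (sub_eq_zero.mp hg.symm)
  · intro h
    apply (piSections_bijective (fun _ : G => (Scheme.Modules.pushforward p).obj E) V).1
    funext g
    dsimp only
    rw [map_zero]
    change ((Pi.π (fun _ : G => (Scheme.Modules.pushforward p).obj E) g).app V
        ((ρ.invariantsDefect E φ).app V s) : Γ(E, p ⁻¹ᵁ V)) = 0
    rw [pi_π_app_invariantsDefect_app, h g, sub_self]

/-- **Sections of the invariants**: a section `s ∈ Γ(E, p⁻¹V) = Γ(p_* E, V)` comes from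
`Γ((p_* E)^G, V)` iff `g · s = s` for all `g` (sections of a kernel are the kernel on sections).
[cite: MumfordAV1970, §7 Thm. p. 66 (2)] -/
theorem mem_range_moduleInvariantsι_app_iff (V : Q.Opens) (s : Γ(E, p ⁻¹ᵁ V)) :
    s ∈ Set.range ((ρ.moduleInvariantsι E φ).app V) ↔ ∀ g : G, ρ.actSections E φ g V s = s := by
  rw [← invariantsDefect_app_eq_zero_iff]
  constructor
  · rintro ⟨x, rfl⟩
    exact app_kernel_ι_app (ρ.invariantsDefect E φ) V x
  · intro h
    obtain ⟨x, hx⟩ := exists_kernel_ι_app_eq (ρ.invariantsDefect E φ) V s h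
    exact ⟨x, hx⟩

/-- Sections of the invariants are invariant. [cite: MumfordAV1970, §7 Thm. p. 66 (2)] -/
theorem actSections_moduleInvariantsι_app (g : G) (V : Q.Opens) (x : Γ(ρ.moduleInvariants E φ, V)) :
    ρ.actSections E φ g V ((ρ.moduleInvariantsι E φ).app V x) = (ρ.moduleInvariantsι E φ).app V x :=
  (ρ.mem_range_moduleInvariantsι_app_iff E φ V _).mp ⟨x, rfl⟩ g

/-- **The invariants of a quasi-coherent module along an affine morphism are quasi-coherent**
(kernel of a morphism between the quasi-coherent `p_* E` and `∏_g p_* E`).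
[cite: MumfordAV1970, §7 Thm. p. 66 (2)] -/
theorem isAffineLocalizing_moduleInvariants [IsAffineHom p] (hE : IsAffineLocalizing E) :
    IsAffineLocalizing (ρ.moduleInvariants E φ) := by
  have hp : IsAffineLocalizing ((Scheme.Modules.pushforward p).obj E) :=
    isAffineLocalizing_pushforward_of_isAffineHom p hE
  have hpi : IsAffineLocalizing (∏ᶜ fun _ : G => (Scheme.Modules.pushforward p).obj E) :=
    (isAffineLocalizing_iff _).mp
      ((isAffineLocalizing Q).prop_pi (fun _ : G => (Scheme.Modules.pushforward p).obj E)
        fun _ => (isAffineLocalizing_iff _).mpr hp)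
  exact IsAffineLocalizing.kernel _ hp hpi

end Invariants

/-! ### The comparison `p^* (p_* E)^G ⟶ E` -/

section Descent

variable [Fintype G]

/-- **The comparison morphism `p^* (p_* E)^G ⟶ E`**: the adjunct of the inclusion
`(p_* E)^G ⟶ p_* E`. [cite: MumfordAV1970, §12 Thm. 1] -/
def descentHom : (Scheme.Modules.pullback p).obj (ρ.moduleInvariants E φ) ⟶ E :=
  ((Scheme.Modules.pullbackPushforwardAdjunction p).homEquiv _ E).symm (ρ.moduleInvariantsι E φ)

/-- The comparison morphism on pulled-back sections: `η(x) ↦ ι(x)`. [cite: MumfordAV1970, §12 Thm. 1 (p. 112)] -/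
theorem descentHom_app_unitSection (V : Q.Opens) (x : Γ(ρ.moduleInvariants E φ, V)) :
    (ρ.descentHom E φ).app (p ⁻¹ᵁ V) (unitSection p (ρ.moduleInvariants E φ) V x) =
      (ρ.moduleInvariantsι E φ).app V x := by
  rw [descentHom, Adjunction.homEquiv_counit]
  simp only [Scheme.Modules.Hom.comp_app, CategoryTheory.comp_apply]
  rw [pullback_map_app_unitSection]
  exact counit_app_unitSection p E V _

omit [Fintype G] in
/-- The action commutes with the algebra map from the base: `g · (p♯(a) b) = p♯(a) (g · b)`.
[cite: MumfordAV1970, §7 Thm. p. 66 (2)] -/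
theorem act_app_mul (g : G) (V : Q.Opens) (a : Γ(Q, V)) (b : Γ(X, p ⁻¹ᵁ V)) :
    ρ.act g V (p.app V a * b) = p.app V a * ρ.act g V b := by
  rw [map_mul, ρ.act_app]

end Descent


end ActionOver

end Literature.AlgebraicGeometry.RelativeSpec
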